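import Summits.BirchSwinnertonDyer.BirchSwinnertonDyer.Theorems.PrintCFramBottomClassIndexLawFiveLeBorelNoPTorsionInputs
import HarnessLib

/-!
# Crux `PrintCFram.BottomClassIndexLawFiveLe` (stmt-BirchSwinnertonDyer-20372), line `eisenstein-resource-bdp-line` v7 (sha16 ec9c97a3778f7d32),
# stub `stub_kolyvaginUpper_borelCM` (S2): the REGISTERED stub is EQUIVALENT, on the class, to the BARE Kolyvagin inequality
# `ord_p #Ш(W/K'') + 2·v_p(c) ≤ 2·ord_p [W(K'') : ℤ·P]` WITHOUT the `p ∤ #𝓞_{K''}^×` binder and WITHOUT the Tamagawa summand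
# (cell `bsd-print-cfram`, width seat `bsd-line-cfram-p1-w4` g2; helper `--supports` 20372; THEOREMS ONLY, 0 facts, 0 definitions)

HONEST FRAMING. Nothing about BSD is proved; S2 is NOT proved. This file is by-name bookkeeping for the LEAD's anatomy of S2: the
registered signature (borel_heegner_squeeze's S2, adopted verbatim into v7 by LEAD g6) carries the field-side binder
`¬ p ∣ Units.torsionOrder K` and concludes `SchneiderFree.Upper.IndexUpperBoundLeAt W p K P (v_p c)`, whose left side contains
`2·ord_p ∏_ℓ c_ℓ(W)`. On the class both are noise: `p ∣ N_W` splits in the Heegner field so `p ∤ #𝓞_K^×`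
(`BorelTorsion.not_dvd_discr_and_not_dvd_torsionOrder_heegnerField_of_cmRamified`), and `ord_p ∏ c_ℓ = 0`
(`BorelTorsion.padicValNat_tamagawaProduct_eq_zero_of_hasCM`). Hence:

* `kolyvaginUpper_borelCM_of_bare` — the REGISTERED S2 VERBATIM ⟸ the bare statement (same frame binders minus `p ∤ #𝓞_K^×`,
  conclusion `ord_p #Ш(W/K) + 2·v_p(c(Dt)) ≤ 2·ord_p [W(K) : ℤP]`);
* `bare_of_kolyvaginUpper_borelCM` — the converse;
so a successor / the LEAD may re-register S2 in the bare form with no loss (`kolyvaginUpper_borelCM_iff_bare`). What S2 then SAYS on the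
class: for every member `W`, every Heegner field `K` of odd discriminant with `L(W^{d_K},1) ≠ 0`, every parametrisation datum `Dt` at
level `N_W` and the Heegner point `P` (non-torsion): `#Ш(W/K)[p^∞] · p^{2 v_p(c)} ∣ [W(K) : ℤP]_p²` in valuation form — Kolyvagin's
inequality at a prime where `ρ̄_{W,p}` is reducible, with the (β)-inputs (`W(K)[p^M] = 0`, `W(K_n)[p^M] = 0` for `p`-unramified Galois
`K_n`) and the Sah homothety for (α) PROVED in the two companion files. beyond-print theorem: NO. BSD is not proved by any of this; no summit
statement is proved by this seat.

References: [GrossLMS1991] §§2, 4; [JetchevSkinnerWan2017] §7.4.1; [Jetchev2008] Thm. 1.1; [GrigorovJorzaPatrikisSteinTarnita2009] Thm. 3.7,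
Props. 5.2–5.4.
-/

-- the summit namespace `Summit.BirchSwinnertonDyer.BirchSwinnertonDyer` repeats the problem name by design (D-0017)
set_option linter.dupNamespace false
set_option autoImplicit false

noncomputable section

open scoped Classical

open WeierstrassCurve NumberField Field IsDedekindDomain
  Literature.NumberTheory.EllipticCurves
  Literature.NumberTheory.EllipticCurves.ModularForms
  Literature.NumberTheory.EllipticCurves.Rank1Residual
  Summit.BirchSwinnertonDyer.Rank1Residual.X12.O11
  Summit.BirchSwinnertonDyer.BirchSwinnertonDyer.Theorems

namespace Summit.BirchSwinnertonDyer.BirchSwinnertonDyer.Theorems.PrintCFram.BorelTorsion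

/-- **REGISTERED S2 VERBATIM ⟸ the bare Kolyvagin inequality.** If for every class member, every odd Heegner frame `(N, K, Dt, H, ι, P)`
with `L(W^{d_K}, 1) ≠ 0` and `P` non-torsion one has `ord_p #Ш(W/K) + 2·v_p(c(Dt)) ≤ 2·ord_p [W(K) : ℤP]`, then the registered stub
`stub_kolyvaginUpper_borelCM` of skeleton v7 holds (its extra binder `p ∤ #𝓞_K^×` is simply not used; its Tamagawa summand vanishes,
`indexUpperBoundLeAt_iff_of_hasCM`). [cite: JetchevSkinnerWan2017, §7.4.1] [cite: GrossLMS1991, §2 Prop. 2.1 ff.] -/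
theorem kolyvaginUpper_borelCM_of_bare
    (hbare : ∀ (W : WeierstrassCurve ℚ) [W.IsElliptic] [W.IsGloballyMinimal] (p : ℕ) [Fact p.Prime],
      W.HasCM → CMRamified W p → 5 ≤ p → W.analyticRank = 1 →
      ∀ (N : ℕ) [NeZero N] (K : Type) [Field K] [NumberField K]
        (Dt : ModularParametrizationData W N) (H : HeegnerDatum N (NumberField.discr K)) (ι : K →+* ℂ)
        (P : (W.baseChange K).toAffine.Point),
        W.conductorNorm ℤ = N → IsImaginaryQuadratic K → Odd (NumberField.discr K) →
        SatisfiesHeegnerHypothesis N K →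
        (W.quadraticTwist (NumberField.discr K : ℚ)).entireLFunction 1 ≠ 0 →
        WeierstrassCurve.Affine.Point.map ι.toRatAlgHom P = heegnerPointComplex Dt H →
        ¬ IsOfFinAddOrder P →
        padicValNat p (W.baseChange K).shaOrder + 2 * padicValNat p Dt.c.natAbs ≤
          2 * padicValNat p (AddSubgroup.zmultiples P).index) :
    ∀ (W : WeierstrassCurve ℚ) [W.IsElliptic] [W.IsGloballyMinimal] (p : ℕ) [Fact p.Prime],
      W.HasCM → CMRamified W p → 5 ≤ p → W.analyticRank = 1 →
      ∀ (N : ℕ) [NeZero N] (K : Type) [Field K] [NumberField K]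
        (Dt : ModularParametrizationData W N) (H : HeegnerDatum N (NumberField.discr K)) (ι : K →+* ℂ)
        (P : (W.baseChange K).toAffine.Point),
        W.conductorNorm ℤ = N → IsImaginaryQuadratic K → Odd (NumberField.discr K) →
        ¬ p ∣ Units.torsionOrder K → SatisfiesHeegnerHypothesis N K →
        (W.quadraticTwist (NumberField.discr K : ℚ)).entireLFunction 1 ≠ 0 →
        WeierstrassCurve.Affine.Point.map ι.toRatAlgHom P = heegnerPointComplex Dt H →
        ¬ IsOfFinAddOrder P →
        SchneiderFree.Upper.IndexUpperBoundLeAt W p K P (padicValNat p Dt.c.natAbs) := by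
  intro W _ _ p _ hCM hram h5 hr N _ K _ _ Dt H ι P hN hK hodd _htor hH hL hP hnt
  rw [indexUpperBoundLeAt_iff_of_hasCM W p hCM h5]
  exact hbare W p hCM hram h5 hr N K Dt H ι P hN hK hodd hH hL hP hnt

/-- **The bare Kolyvagin inequality ⟸ REGISTERED S2 VERBATIM**: the binder `p ∤ #𝓞_K^×` of the registered stub is discharged on the class
(`p ∣ N_W = N` splits in `K`: `not_dvd_discr_and_not_dvd_torsionOrder_heegnerField_of_cmRamified`), and the Tamagawa summand vanishes.
[cite: GrossLMS1991, §1 (p. 235)] [cite: JetchevSkinnerWan2017, §7.4.1] -/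
theorem bare_of_kolyvaginUpper_borelCM
    (hS2 : ∀ (W : WeierstrassCurve ℚ) [W.IsElliptic] [W.IsGloballyMinimal] (p : ℕ) [Fact p.Prime],
      W.HasCM → CMRamified W p → 5 ≤ p → W.analyticRank = 1 →
      ∀ (N : ℕ) [NeZero N] (K : Type) [Field K] [NumberField K]
        (Dt : ModularParametrizationData W N) (H : HeegnerDatum N (NumberField.discr K)) (ι : K →+* ℂ)
        (P : (W.baseChange K).toAffine.Point),
        W.conductorNorm ℤ = N → IsImaginaryQuadratic K → Odd (NumberField.discr K) →
        ¬ p ∣ Units.torsionOrder K → SatisfiesHeegnerHypothesis N K →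
        (W.quadraticTwist (NumberField.discr K : ℚ)).entireLFunction 1 ≠ 0 →
        WeierstrassCurve.Affine.Point.map ι.toRatAlgHom P = heegnerPointComplex Dt H →
        ¬ IsOfFinAddOrder P →
        SchneiderFree.Upper.IndexUpperBoundLeAt W p K P (padicValNat p Dt.c.natAbs)) :
    ∀ (W : WeierstrassCurve ℚ) [W.IsElliptic] [W.IsGloballyMinimal] (p : ℕ) [Fact p.Prime],
      W.HasCM → CMRamified W p → 5 ≤ p → W.analyticRank = 1 →
      ∀ (N : ℕ) [NeZero N] (K : Type) [Field K] [NumberField K]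
        (Dt : ModularParametrizationData W N) (H : HeegnerDatum N (NumberField.discr K)) (ι : K →+* ℂ)
        (P : (W.baseChange K).toAffine.Point),
        W.conductorNorm ℤ = N → IsImaginaryQuadratic K → Odd (NumberField.discr K) →
        SatisfiesHeegnerHypothesis N K →
        (W.quadraticTwist (NumberField.discr K : ℚ)).entireLFunction 1 ≠ 0 →
        WeierstrassCurve.Affine.Point.map ι.toRatAlgHom P = heegnerPointComplex Dt H →
        ¬ IsOfFinAddOrder P →
        padicValNat p (W.baseChange K).shaOrder + 2 * padicValNat p Dt.c.natAbs ≤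
          2 * padicValNat p (AddSubgroup.zmultiples P).index := by
  intro W _ _ p _ hCM hram h5 hr N _ K _ _ Dt H ι P hN hK hodd hH hL hP hnt
  have hH' : SatisfiesHeegnerHypothesis (W.conductorNorm ℤ) K := by rw [hN]; exact hH
  have htor : ¬ p ∣ Units.torsionOrder K :=
    (not_dvd_discr_and_not_dvd_torsionOrder_heegnerField_of_cmRamified W p hCM h5 hram K hK hH').2
  rw [← indexUpperBoundLeAt_iff_of_hasCM W p hCM h5]
  exact hS2 W p hCM hram h5 hr N K Dt H ι P hN hK hodd htor hH hL hP hnt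

/-- **S2 registered ⟺ S2 bare**, on the class. [cite: JetchevSkinnerWan2017, §7.4.1] -/
theorem kolyvaginUpper_borelCM_iff_bare :
    (∀ (W : WeierstrassCurve ℚ) [W.IsElliptic] [W.IsGloballyMinimal] (p : ℕ) [Fact p.Prime],
      W.HasCM → CMRamified W p → 5 ≤ p → W.analyticRank = 1 →
      ∀ (N : ℕ) [NeZero N] (K : Type) [Field K] [NumberField K]
        (Dt : ModularParametrizationData W N) (H : HeegnerDatum N (NumberField.discr K)) (ι : K →+* ℂ)
        (P : (W.baseChange K).toAffine.Point),
        W.conductorNorm ℤ = N → IsImaginaryQuadratic K → Odd (NumberField.discr K) →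
        ¬ p ∣ Units.torsionOrder K → SatisfiesHeegnerHypothesis N K →
        (W.quadraticTwist (NumberField.discr K : ℚ)).entireLFunction 1 ≠ 0 →
        WeierstrassCurve.Affine.Point.map ι.toRatAlgHom P = heegnerPointComplex Dt H →
        ¬ IsOfFinAddOrder P →
        SchneiderFree.Upper.IndexUpperBoundLeAt W p K P (padicValNat p Dt.c.natAbs)) ↔
    (∀ (W : WeierstrassCurve ℚ) [W.IsElliptic] [W.IsGloballyMinimal] (p : ℕ) [Fact p.Prime],
      W.HasCM → CMRamified W p → 5 ≤ p → W.analyticRank = 1 →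
      ∀ (N : ℕ) [NeZero N] (K : Type) [Field K] [NumberField K]
        (Dt : ModularParametrizationData W N) (H : HeegnerDatum N (NumberField.discr K)) (ι : K →+* ℂ)
        (P : (W.baseChange K).toAffine.Point),
        W.conductorNorm ℤ = N → IsImaginaryQuadratic K → Odd (NumberField.discr K) →
        SatisfiesHeegnerHypothesis N K →
        (W.quadraticTwist (NumberField.discr K : ℚ)).entireLFunction 1 ≠ 0 →
        WeierstrassCurve.Affine.Point.map ι.toRatAlgHom P = heegnerPointComplex Dt H →
        ¬ IsOfFinAddOrder P →
        padicValNat p (W.baseChange K).shaOrder + 2 * padicValNat p Dt.c.natAbs ≤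
          2 * padicValNat p (AddSubgroup.zmultiples P).index) :=
  ⟨fun h ↦ bare_of_kolyvaginUpper_borelCM h, fun h ↦ kolyvaginUpper_borelCM_of_bare h⟩

/-- **Pointwise (per member, per frame) form of the reduction**, for the LEAD's composition: at ONE frame, the registered conclusion
`IndexUpperBoundLeAt W p K P (v_p c)` is the bare inequality. [cite: JetchevSkinnerWan2017, §7.4.1] -/
theorem indexUpperBoundLeAt_manin_iff_of_cmRamified (W : WeierstrassCurve ℚ) [W.IsElliptic] (p : ℕ) [Fact p.Prime]
    (hCM : W.HasCM) (h5 : 5 ≤ p) {N : ℕ} [NeZero N] (K : Type) [Field K] [NumberField K] (Dt : ModularParametrizationData W N)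
    (P : (W.baseChange K).toAffine.Point) :
    SchneiderFree.Upper.IndexUpperBoundLeAt W p K P (padicValNat p Dt.c.natAbs) ↔
      padicValNat p (W.baseChange K).shaOrder + 2 * padicValNat p Dt.c.natAbs ≤
        2 * padicValNat p (AddSubgroup.zmultiples P).index :=
  indexUpperBoundLeAt_iff_of_hasCM W p hCM h5 K P _

end Summit.BirchSwinnertonDyer.BirchSwinnertonDyer.Theorems.PrintCFram.BorelTorsion

end
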